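import Literature.Analysis.FluidPDE.LocalHelmholtzSlice
import Literature.Analysis.FluidPDE.NewtonTestPotential
import Literature.Analysis.FluidPDE.SuitableWeak
import Literature.Analysis.FluidPDE.MollifiedLimits
import Literature.Analysis.FunctionSpaces.MollificationLp
import HarnessLib

/-!
# The localised Helmholtz decomposition of an `L^q` force on a parabolic cylinder

Analysis/FluidPDE support file (everything proved, no named facts) in the decomposition of the
named fact `Literature.Analysis.FluidPDE.lemarieRieusset_epsilon_regularity_nu_one`
(`CKNEpsilonRegularityViscosity`; Lemarié-Rieusset 2016, Thm. 14.4 at `ν = 1`, `r₀ = 1`),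
continuing `LocalHelmholtzSlice`. Given a field `g ∈ L^q(ℝ × ℝ³; ℝ³)` supported in the unit
parabolic cylinder `Q₁ = Q_1(z₀)` (in the application `g = 1_{Q₁} f` for the force `f` of a
suitable weak solution), we construct `π ∈ L^{3/2}(ℝ × ℝ³)` and `𝒢 ∈ L^q(ℝ × ℝ³; ℝ³)` with

* `𝒢 = ∇ₓ π` weakly in space–time (`∫∫ π div ψ = -∫∫ ⟪𝒢, ψ⟫` for vector test fields `ψ`);
* `g - 𝒢` is weakly divergence free on `Q₁` (`∫∫ ⟪g - 𝒢, ∇θ⟫ = 0` for `θ ∈ C_c^∞(Q₁)`);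
* the linear bounds `‖𝒢‖_{L^q} ≤ C_q ‖g‖_{L^q}`, `‖π‖_{L^{3/2}} ≤ C ‖g‖_{L^{3/2}}` with constants
  depending on `q` only (not on the centre `z₀`);
* smooth compactly supported approximants `πₖ` with `πₖ → π` in `L^{3/2}` and `∇ₓπₖ → 𝒢` in
  `L^q` (used downstream to transfer the local energy inequality).

This is the classical device "the gradient part of the force can be absorbed into the pressure"
(Caffarelli–Kohn–Nirenberg 1982, §1), carried out at the level of generality of
Lemarié-Rieusset's Thm. 14.4 (`f ∈ L^q_{t,x}` only): the new pressure `p - π` and the new,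
solenoidal force `f - 𝒢` are again in the classes of the theorem (`CKNEpsilonRegularityForce`).

## Construction

Mollify `g` in space–time by normalised bump kernels of radius `< 1/2` (`gₙ`, smooth, supported
in a fixed neighbourhood of `Q̄₁`, `gₙ → g` in `L^q` and in `L^{3/2}`, tree
`FunctionSpaces.tendsto_eLpNorm_normed_convolution_sub_self`); apply the slice potential
`P` of `LocalHelmholtzSlice` at each time, `πₙ(t, ·) = P[gₙ(t, ·)]`, `𝒢ₙ = ∇ₓπₙ` (jointly smooth
and compactly supported: the slicewise truncated potential of a test function is a test
function, `IsSpaceTimeTestOn.newtonNearPotential_slice`). The slice bounds of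
`LocalHelmholtzSlice` integrate in time (Tonelli) to
`‖𝒢ₙ - 𝒢ₘ‖_{L^q} ≤ C_q ‖gₙ - gₘ‖_{L^q}`, `‖πₙ - πₘ‖_{L^{3/2}} ≤ C ‖gₙ - gₘ‖_{L^{3/2}}`, so along a fast
subsequence both are Cauchy with summable rate and converge in `L^q`, resp. `L^{3/2}`
(`MeasureTheory.Lp.cauchy_complete_eLpNorm`); the identities of the smooth level
(`∫ πₙ div ψ = -∫ ⟪∇πₙ, ψ⟫`, `div (gₙ - ∇πₙ) = 0` on the ball `B(x₀, 2)`) pass to the limit.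

## References

* L. Caffarelli, R. Kohn, L. Nirenberg, *Partial regularity of suitable weak solutions of the
  Navier–Stokes equations*, Comm. Pure Appl. Math. 35 (1982), 771–831, §1. [CaffarelliKohnNirenberg1982]
* P. G. Lemarié-Rieusset, *The Navier–Stokes Problem in the 21st Century*, CRC Press (2016),
  Thm. 14.4. [LemarieRieusset2016]
* L. C. Evans, *Partial Differential Equations*, 2nd ed. (2010), App. C.4 (mollifiers).
-/

noncomputable section

open MeasureTheory Set Function Filter Topology TopologicalSpace Metric InnerProductSpace
open scoped NNReal ENNReal RealInnerProductSpace Laplacian ContDiff Convolution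

namespace Literature.Analysis.FluidPDE

namespace LocalHelmholtz

/-- Local notation for physical space `ℝ³ = EuclideanSpace ℝ (Fin 3)`. -/
local notation "ℝ³" => EuclideanSpace ℝ (Fin 3)

/-- Lebesgue measure on `ℝ × ℝ³` is an additive Haar measure (the product instance
`Measure.prod.instIsAddHaarMeasure`, which instance search does not find through `volume`; cf.
`SpaceTimeMollifier`). -/
local instance instIsAddHaarMeasureVolumeSpaceTime3 :
    (volume : Measure (ℝ × ℝ³)).IsAddHaarMeasure :=
  Measure.prod.instIsAddHaarMeasure _ _

/-! ### Tonelli: slice bounds integrate to space–time bounds -/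

section Tonelli

variable {X Y : Type*} [MeasurableSpace X] [MeasurableSpace Y] {μ : Measure X} {ν : Measure Y}
  [SFinite ν] {F₁ F₂ : Type*} [NormedAddCommGroup F₁] [NormedAddCommGroup F₂]

/-- **Slice bounds integrate.** If for every `x` the slice `F(x, ·)` is bounded in `L^p(ν)` by
`C` times the slice `G(x, ·)`, then `‖F‖_{L^p(μ ⊗ ν)} ≤ C ‖G‖_{L^p(μ ⊗ ν)}` (`0 < p < ∞`; Tonelli).
[folklore] -/
theorem eLpNorm_prod_le_of_slice_le {F : X × Y → F₁} {G : X × Y → F₂}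
    (hF : AEStronglyMeasurable F (μ.prod ν)) (hG : AEStronglyMeasurable G (μ.prod ν))
    {p : ℝ≥0∞} (hp0 : p ≠ 0) (hptop : p ≠ ⊤) {C : ℝ≥0∞}
    (h : ∀ x, eLpNorm (fun y => F (x, y)) p ν ≤ C * eLpNorm (fun y => G (x, y)) p ν) :
    eLpNorm F p (μ.prod ν) ≤ C * eLpNorm G p (μ.prod ν) := by
  have hq : 0 < p.toReal := ENNReal.toReal_pos hp0 hptop
  rw [eLpNorm_eq_lintegral_rpow_enorm_toReal hp0 hptop, eLpNorm_eq_lintegral_rpow_enorm_toReal hp0 hptop,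
    lintegral_prod _ (hF.enorm.pow_const _), lintegral_prod _ (hG.enorm.pow_const _)]
  have hslice : ∀ x, ∫⁻ y, ‖F (x, y)‖ₑ ^ p.toReal ∂ν ≤
      C ^ p.toReal * ∫⁻ y, ‖G (x, y)‖ₑ ^ p.toReal ∂ν := by
    intro x
    have h1 := h x
    rw [eLpNorm_eq_lintegral_rpow_enorm_toReal hp0 hptop, eLpNorm_eq_lintegral_rpow_enorm_toReal hp0 hptop] at h1
    have h2 := ENNReal.rpow_le_rpow h1 hq.le
    rw [ENNReal.mul_rpow_of_nonneg _ _ hq.le, ← ENNReal.rpow_mul, ← ENNReal.rpow_mul,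
      one_div_mul_cancel hq.ne', ENNReal.rpow_one, ENNReal.rpow_one] at h2
    exact h2
  calc (∫⁻ x, ∫⁻ y, ‖F (x, y)‖ₑ ^ p.toReal ∂ν ∂μ) ^ (1 / p.toReal)
      ≤ (∫⁻ x, C ^ p.toReal * ∫⁻ y, ‖G (x, y)‖ₑ ^ p.toReal ∂ν ∂μ) ^ (1 / p.toReal) :=
        ENNReal.rpow_le_rpow (lintegral_mono fun x => hslice x) (by positivity)
    _ = (C ^ p.toReal * ∫⁻ x, ∫⁻ y, ‖G (x, y)‖ₑ ^ p.toReal ∂ν ∂μ) ^ (1 / p.toReal) := by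
        rw [lintegral_const_mul'' _ (hG.enorm.pow_const _).lintegral_prod_right']
    _ = C * (∫⁻ x, ∫⁻ y, ‖G (x, y)‖ₑ ^ p.toReal ∂ν ∂μ) ^ (1 / p.toReal) := by
        rw [ENNReal.mul_rpow_of_nonneg _ _ (by positivity), ← ENNReal.rpow_mul,
          mul_one_div_cancel hq.ne', ENNReal.rpow_one]

end Tonelli

/-! ### Geometry: the unit cylinder, its closure, and the enlarged cylinders -/

section Geometry

variable (z₀ : ℝ × ℝ³)

/-- The closure of the unit parabolic cylinder is compact. [folklore] -/
theorem isCompact_closure_parabolicCylinder_one :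
    IsCompact (closure (parabolicCylinder 1 z₀)) := by
  refine ((isCompact_Icc (a := z₀.1 - 1 ^ 2) (b := z₀.1)).prod
    (isCompact_closedBall z₀.2 1)).of_isClosed_subset isClosed_closure ?_
  refine closure_minimal ?_ (isClosed_Icc.prod isClosed_closedBall)
  rw [parabolicCylinder]
  exact prod_mono Ioo_subset_Icc_self ball_subset_closedBall

/-- The open cylinder `(t₀ - 2, t₀ + 1) × B(x₀, R)` around `Q₁(z₀)`, as an `Opens`. [folklore] -/
def cyl (R : ℝ) : Opens (ℝ × ℝ³) :=
  ⟨Ioo (z₀.1 - 2) (z₀.1 + 1) ×ˢ ball z₀.2 R, isOpen_Ioo.prod isOpen_ball⟩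

/-- The underlying set of `cyl`. [folklore] -/
theorem coe_cyl (R : ℝ) : ((cyl z₀ R : Opens (ℝ × ℝ³)) : Set (ℝ × ℝ³)) =
    Ioo (z₀.1 - 2) (z₀.1 + 1) ×ˢ ball z₀.2 R := rfl

end Geometry

/-! ### Space–time mollification of a field supported in `Q₁` -/

section Mollify

variable (z₀ : ℝ × ℝ³) {g : ℝ × ℝ³ → ℝ³}

/-- The bump kernels of the construction: radii `(1/(2(n+2)), 1/(n+2))`. [folklore] -/
def bump (n : ℕ) : ContDiffBump (0 : ℝ × ℝ³) where
  rIn := 1 / (2 * (n + 2))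
  rOut := 1 / (n + 2)
  rIn_pos := by positivity
  rIn_lt_rOut := by
    rw [div_lt_div_iff₀ (by positivity) (by positivity)]
    nlinarith

/-- The outer radius of the `n`-th bump kernel. [folklore] -/
theorem bump_rOut (n : ℕ) : (bump n).rOut = 1 / (n + 2) := rfl

/-- The outer radii are at most `1/2`. [folklore] -/
theorem bump_rOut_le (n : ℕ) : (bump n).rOut ≤ 1 / 2 := by
  rw [bump_rOut, div_le_div_iff₀ (by positivity) (by positivity)]
  have : (0 : ℝ) ≤ n := n.cast_nonneg
  linarith

/-- The outer radii tend to `0`. [folklore] -/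
theorem tendsto_bump_rOut : Tendsto (fun n => (bump n).rOut) atTop (𝓝 0) := by
  have h : Tendsto (fun n : ℕ => (1 : ℝ) / ((n : ℝ) + 1)) atTop (𝓝 0) :=
    tendsto_one_div_add_atTop_nhds_zero_nat
  refine (h.comp (tendsto_add_atTop_nat 1)).congr fun n => ?_
  simp only [Function.comp_apply, bump_rOut]
  push_cast
  ring

/-- **The mollified field** `gₙ = ρₙ ⋆ g` (normalised bump kernel of radius `1/(n+2)`).
[folklore] -/
def moll (n : ℕ) (g : ℝ × ℝ³ → ℝ³) : ℝ × ℝ³ → ℝ³ :=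
  (bump n).normed volume ⋆[ContinuousLinearMap.lsmul ℝ ℝ, volume] g

variable {z₀}

/-- A field supported in `Q₁` has compact support. [folklore] -/
theorem hasCompactSupport_of_support_subset (hgs : support g ⊆ parabolicCylinder 1 z₀) :
    HasCompactSupport g :=
  HasCompactSupport.intro' (isCompact_closure_parabolicCylinder_one z₀) isClosed_closure
    fun z hz => by
      by_contra h
      exact hz (subset_closure (hgs h))

/-- The mollified field is smooth (the kernel is smooth with compact support, `g` is locally
integrable). [folklore] -/
theorem contDiff_moll {p : ℝ≥0∞} (hg : MemLp g p volume) (hp : 1 ≤ p) (n : ℕ) :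
    ContDiff ℝ ∞ (moll n g) :=
  (bump n).hasCompactSupport_normed.contDiff_convolution_left _ (bump n).contDiff_normed
    (hg.locallyIntegrable hp)

/-- The mollified field has compact support. [folklore] -/
theorem hasCompactSupport_moll (hgs : support g ⊆ parabolicCylinder 1 z₀) (n : ℕ) :
    HasCompactSupport (moll n g) :=
  (bump n).hasCompactSupport_normed.convolution _ (hasCompactSupport_of_support_subset hgs)

/-- **Support of the mollified field**: `supp gₙ ⊆ B(0, 1/2) + Q₁ ⊆ (t₀ - 3/2, t₀ + 1/2) × B(x₀, 3/2)`.
[folklore] -/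
theorem support_moll_subset (hgs : support g ⊆ parabolicCylinder 1 z₀) (n : ℕ) :
    support (moll n g) ⊆ Ioo (z₀.1 - 3 / 2) (z₀.1 + 1 / 2) ×ˢ ball z₀.2 (3 / 2) := by
  intro z hz
  have h1 := support_convolution_subset (L := ContinuousLinearMap.lsmul ℝ ℝ) (μ := volume)
    (f := (bump n).normed volume) (g := g) hz
  rw [(bump n).support_normed_eq] at h1
  obtain ⟨a, ha, b, hb, rfl⟩ := h1
  have hb' := hgs hb
  rw [mem_parabolicCylinder] at hb'
  rw [mem_ball, Prod.dist_eq, max_lt_iff] at ha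
  obtain ⟨ha1, ha2⟩ := ha
  simp only [Prod.fst_zero, Prod.snd_zero, dist_zero_right, Real.norm_eq_abs] at ha1 ha2
  have hr := bump_rOut_le n
  obtain ⟨⟨hb1, hb2⟩, hb3⟩ := hb'
  refine ⟨⟨?_, ?_⟩, ?_⟩
  · simp only [Prod.fst_add]
    have := (abs_lt.1 (ha1.trans_le hr)).1
    nlinarith
  · simp only [Prod.fst_add]
    have := (abs_lt.1 (ha1.trans_le hr)).2
    linarith
  · simp only [Prod.snd_add, mem_ball]
    calc dist (a.2 + b.2) z₀.2 ≤ ‖a.2‖ + dist b.2 z₀.2 := by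
          rw [dist_eq_norm, dist_eq_norm, show a.2 + b.2 - z₀.2 = a.2 + (b.2 - z₀.2) by abel]
          exact norm_add_le _ _
      _ < 1 / 2 + 1 := add_lt_add (ha2.trans_le hr) hb3
      _ = 3 / 2 := by norm_num

/-- The topological support of the mollified field lies in the compact box
`[t₀ - 3/2, t₀ + 1/2] × B̄(x₀, 3/2)`. [folklore] -/
theorem tsupport_moll_subset (hgs : support g ⊆ parabolicCylinder 1 z₀) (n : ℕ) :
    tsupport (moll n g) ⊆ Icc (z₀.1 - 3 / 2) (z₀.1 + 1 / 2) ×ˢ closedBall z₀.2 (3 / 2) :=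
  closure_minimal ((support_moll_subset hgs n).trans (prod_mono Ioo_subset_Icc_self
    ball_subset_closedBall)) (isClosed_Icc.prod isClosed_closedBall)

/-- The mollified field, curried, is a space–time test field on the cylinder
`(t₀ - 2, t₀ + 1) × B(x₀, 2)`. [folklore] -/
theorem isSpaceTimeTestOn_moll {p : ℝ≥0∞} (hg : MemLp g p volume) (hp : 1 ≤ p)
    (hgs : support g ⊆ parabolicCylinder 1 z₀) (n : ℕ) :
    IsSpaceTimeTestOn (cyl z₀ 2) (curry (moll n g)) := by
  refine ⟨?_, ?_, ?_⟩
  · rw [uncurry_curry]; exact contDiff_moll hg hp n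
  · rw [uncurry_curry]; exact hasCompactSupport_moll hgs n
  · rw [uncurry_curry, coe_cyl]
    refine (tsupport_moll_subset hgs n).trans (prod_mono ?_ ?_)
    · intro t ht; exact ⟨by linarith [ht.1], by linarith [ht.2]⟩
    · exact closedBall_subset_ball (by norm_num)

/-- The time slices of the mollified field are supported in `B(x₀, 2)` (indeed in
`B̄(x₀, 3/2)`). [folklore] -/
theorem tsupport_moll_slice_subset (hgs : support g ⊆ parabolicCylinder 1 z₀) (n : ℕ) (t : ℝ) :
    tsupport (curry (moll n g) t) ⊆ ball z₀.2 2 := by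
  refine (closure_minimal (fun x hx => ?_) isClosed_closedBall).trans
    (closedBall_subset_ball (by norm_num : (3 / 2 : ℝ) < 2))
  have hz : (t, x) ∈ support (moll n g) := hx
  exact ball_subset_closedBall ((support_moll_subset hgs n hz).2)

/-- `gₙ → g` in `L^p` for `g ∈ L^p`, `1 ≤ p < ∞`. [folklore] -/
theorem tendsto_eLpNorm_moll_sub {p : ℝ≥0∞} (hg : MemLp g p volume) (hp : 1 ≤ p)
    (hp' : p ≠ ⊤) : Tendsto (fun n => eLpNorm (moll n g - g) p volume) atTop (𝓝 0) :=
  FunctionSpaces.tendsto_eLpNorm_normed_convolution_sub_self tendsto_bump_rOut hp hp' hg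

/-- `‖gₙ‖_{L^p} ≤ ‖g‖_{L^p}` (Young). [folklore] -/
theorem eLpNorm_moll_le {p : ℝ≥0∞} (hg : AEStronglyMeasurable g volume) (hp : 1 ≤ p) (n : ℕ) :
    eLpNorm (moll n g) p volume ≤ eLpNorm g p volume :=
  FunctionSpaces.eLpNorm_normed_convolution_le_haar (bump n) hg hp

end Mollify

/-! ### The smooth potentials `πₙ` and their gradients -/

section Smooth

variable {z₀ : ℝ × ℝ³} {g : ℝ × ℝ³ → ℝ³} {p : ℝ≥0∞}

/-- Off the support of a space–time field, the point is off the support of the slice.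
[folklore] -/
theorem notMem_tsupport_slice {F : Type*} [Zero F] [TopologicalSpace F] {ψ : ℝ → ℝ³ → F}
    {t : ℝ} {x : ℝ³} (h : (t, x) ∉ tsupport (uncurry ψ)) : x ∉ tsupport (ψ t) := by
  intro hx
  have hcl : IsClosed {y : ℝ³ | (t, y) ∈ tsupport (uncurry ψ)} :=
    (isClosed_tsupport _).preimage (continuous_const.prodMk continuous_id)
  exact h ((closure_minimal (fun y (hy : y ∈ support (ψ t)) =>
    subset_tsupport (uncurry ψ) hy) hcl) hx)

/-- Off the support of a space–time field, the divergence of the slice vanishes. [folklore] -/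
theorem divergence_slice_eq_zero_of_notMem {ψ : ℝ → ℝ³ → ℝ³} {t : ℝ} {x : ℝ³}
    (h : (t, x) ∉ tsupport (uncurry ψ)) : VectorCalculus.divergence (ψ t) x = 0 :=
  divergence_eq_zero_of_notMem_tsupport (notMem_tsupport_slice h)

/-- Off the support of a space–time function, the gradient of the slice vanishes. [folklore] -/
theorem gradient_slice_eq_zero_of_notMem {θ : ℝ → ℝ³ → ℝ} {t : ℝ} {x : ℝ³}
    (h : (t, x) ∉ tsupport (uncurry θ)) : gradient (θ t) x = 0 :=
  gradient_eq_zero_of_notMem_tsupport (notMem_tsupport_slice h)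

/-- Off the support of a space–time field, the spatial derivative of the slice vanishes.
[folklore] -/
theorem fderiv_slice_eq_zero_of_notMem' {F : Type*} [NormedAddCommGroup F] [NormedSpace ℝ F]
    {ψ : ℝ → ℝ³ → F} {t : ℝ} {x : ℝ³} (h : (t, x) ∉ tsupport (uncurry ψ)) :
    fderiv ℝ (ψ t) x = 0 := by
  have h0 : uncurry ψ =ᶠ[𝓝 (t, x)] 0 := notMem_tsupport_iff_eventuallyEq.1 h
  have hc : Continuous fun y : ℝ³ => (t, y) := continuous_const.prodMk continuous_id
  have h1 : ψ t =ᶠ[𝓝 x] fun _ => (0 : F) := (hc.tendsto x).eventually h0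
  rw [h1.fderiv_eq, fderiv_fun_const]
  rfl

/-- The operator-valued spatial derivative of a space–time test field is jointly smooth.
[folklore] -/
theorem contDiff_uncurry_fderiv_slice {F : Type*} [NormedAddCommGroup F] [NormedSpace ℝ F]
    {Q : Opens (ℝ × ℝ³)} {ψ : ℝ → ℝ³ → F} (hψ : IsSpaceTimeTestOn Q ψ) :
    ContDiff ℝ ∞ (uncurry fun t x => fderiv ℝ (ψ t) x) := by
  have hψ' : IsSpaceTimeTestOn (⊤ : Opens (ℝ × ℝ³)) ψ := hψ.mono le_top
  have h := (hψ'.isSmoothSpaceTimeOn univ).isSmoothSpaceTimeOn_fderiv_of_isOpen isOpen_univ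
  rw [IsSmoothSpaceTimeOn, univ_prod_univ, contDiffOn_univ] at h
  exact h

/-- The spatial gradient field of a space–time test function is a space–time test field on
the same set (cf. `IsSpaceTimeTestOn.gradient_isSpaceTimeTestOn`, not imported here).
[folklore] -/
theorem isSpaceTimeTestOn_gradient {Q : Opens (ℝ × ℝ³)} {θ : ℝ → ℝ³ → ℝ}
    (hθ : IsSpaceTimeTestOn Q θ) : IsSpaceTimeTestOn Q (fun t x => gradient (θ t) x) := by
  have hD := contDiff_uncurry_fderiv_slice hθ
  have h0 : ∀ z : ℝ × ℝ³, z ∉ tsupport (uncurry θ) → gradient (θ z.1) z.2 = 0 := by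
    rintro ⟨t, x⟩ hz
    simp [gradient, fderiv_slice_eq_zero_of_notMem' hz]
  refine ⟨(InnerProductSpace.toDual ℝ ℝ³).symm.contDiff.comp hD,
    HasCompactSupport.intro hθ.hasCompactSupport h0, ?_⟩
  refine (closure_minimal (fun z hz => ?_) (isClosed_tsupport _)).trans hθ.tsupport_subset
  by_contra hz'
  exact hz (h0 z hz')

/-- The spatial divergence field of a space–time test field is a space–time test function on
the same set. [folklore] -/
theorem isSpaceTimeTestOn_divergence {Q : Opens (ℝ × ℝ³)} {ψ : ℝ → ℝ³ → ℝ³}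
    (hψ : IsSpaceTimeTestOn Q ψ) :
    IsSpaceTimeTestOn Q (fun t x => VectorCalculus.divergence (ψ t) x) := by
  have hD : ContDiff ℝ ∞ (uncurry fun t x => fderiv ℝ (ψ t) x) := contDiff_uncurry_fderiv_slice hψ
  set b := EuclideanSpace.basisFun (Fin 3) ℝ
  have hfun : (uncurry fun t x => VectorCalculus.divergence (ψ t) x) =
      fun z : ℝ × ℝ³ => ∑ i, ⟪(b i : ℝ³), (uncurry (fun t x => fderiv ℝ (ψ t) x) z) (b i)⟫ := by
    funext z
    exact divergence_eq_sum_inner_fderiv b (ψ z.1) z.2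
  have h0 : ∀ z : ℝ × ℝ³, z ∉ tsupport (uncurry ψ) →
      (uncurry fun t x => VectorCalculus.divergence (ψ t) x) z = 0 := by
    rintro ⟨t, x⟩ hz
    exact divergence_slice_eq_zero_of_notMem hz
  refine ⟨?_, ?_, ?_⟩
  · rw [hfun]
    exact ContDiff.sum fun i _ => contDiff_const.inner ℝ (hD.clm_apply contDiff_const)
  · exact HasCompactSupport.intro hψ.hasCompactSupport fun z hz => h0 z hz
  · refine (closure_minimal (fun z hz => ?_) (isClosed_tsupport _)).trans hψ.tsupport_subset
    by_contra h
    exact hz (h0 z h)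

variable (g)

/-- The time slices `gₙ(t, ·)` of the mollified field. [folklore] -/
def slice (n : ℕ) (t : ℝ) : ℝ³ → ℝ³ := curry (moll n g) t

/-- **The smooth potentials** `πₙ(t, ·) = P[gₙ(t, ·)]`. [folklore] -/
def piN (n : ℕ) (t : ℝ) (x : ℝ³) : ℝ := potential (slice g n t) x

/-- **Their spatial gradients** `𝒢ₙ(t, ·) = ∇P[gₙ(t, ·)]`. [folklore] -/
def gradN (n : ℕ) (t : ℝ) (x : ℝ³) : ℝ³ := gradient (piN g n t) x

variable {g}

/-- Unfolding `slice`. [folklore] -/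
theorem slice_apply (n : ℕ) (t : ℝ) (x : ℝ³) : slice g n t x = moll n g (t, x) := rfl

/-- The slices of the mollified field are smooth. [folklore] -/
theorem contDiff_slice (hg : MemLp g p volume) (hp : 1 ≤ p) (n : ℕ) (t : ℝ) :
    ContDiff ℝ ∞ (slice g n t) :=
  (contDiff_moll hg hp n).comp (contDiff_prodMk_right t)

/-- The slices of the mollified field have compact support. [folklore] -/
theorem hasCompactSupport_slice (hgs : support g ⊆ parabolicCylinder 1 z₀) (n : ℕ) (t : ℝ) :
    HasCompactSupport (slice g n t) :=
  (isCompact_closedBall z₀.2 2).of_isClosed_subset (isClosed_tsupport _)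
    ((tsupport_moll_slice_subset hgs n t).trans ball_subset_closedBall)

/-- The slices of the mollified field are supported in `B(x₀, 2)`. [folklore] -/
theorem tsupport_slice_subset (hgs : support g ⊆ parabolicCylinder 1 z₀) (n : ℕ) (t : ℝ) :
    tsupport (slice g n t) ⊆ ball z₀.2 2 :=
  tsupport_moll_slice_subset hgs n t

/-- `πₙ` is a space–time test function on the cylinder `(t₀ - 2, t₀ + 1) × B(x₀, 10)`.
[folklore] -/
theorem isSpaceTimeTestOn_piN (hg : MemLp g p volume) (hp : 1 ≤ p)
    (hgs : support g ⊆ parabolicCylinder 1 z₀) (n : ℕ) :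
    IsSpaceTimeTestOn (cyl z₀ (2 + 8)) (piN g n) := by
  have hdiv := isSpaceTimeTestOn_divergence (isSpaceTimeTestOn_moll hg hp hgs n)
  exact hdiv.newtonNearPotential_slice (by norm_num) (by norm_num)

/-- `πₙ` is a space–time test function on all of `ℝ × ℝ³`. [folklore] -/
theorem isSpaceTimeTestOn_piN_top (hg : MemLp g p volume) (hp : 1 ≤ p)
    (hgs : support g ⊆ parabolicCylinder 1 z₀) (n : ℕ) :
    IsSpaceTimeTestOn (⊤ : Opens (ℝ × ℝ³)) (piN g n) :=
  (isSpaceTimeTestOn_piN hg hp hgs n).mono le_top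

/-- `𝒢ₙ` is a space–time test field on all of `ℝ × ℝ³`. [folklore] -/
theorem isSpaceTimeTestOn_gradN_top (hg : MemLp g p volume) (hp : 1 ≤ p)
    (hgs : support g ⊆ parabolicCylinder 1 z₀) (n : ℕ) :
    IsSpaceTimeTestOn (⊤ : Opens (ℝ × ℝ³)) (gradN g n) :=
  isSpaceTimeTestOn_gradient (isSpaceTimeTestOn_piN_top hg hp hgs n)

/-- `πₙ`, uncurried, is in every `L^r`. [folklore] -/
theorem memLp_piN (hg : MemLp g p volume) (hp : 1 ≤ p)
    (hgs : support g ⊆ parabolicCylinder 1 z₀) (n : ℕ) (r : ℝ≥0∞) :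
    MemLp (uncurry (piN g n)) r volume :=
  (isSpaceTimeTestOn_piN_top hg hp hgs n).contDiff.continuous.memLp_of_hasCompactSupport
    (isSpaceTimeTestOn_piN_top hg hp hgs n).hasCompactSupport

/-- `𝒢ₙ`, uncurried, is in every `L^r`. [folklore] -/
theorem memLp_gradN (hg : MemLp g p volume) (hp : 1 ≤ p)
    (hgs : support g ⊆ parabolicCylinder 1 z₀) (n : ℕ) (r : ℝ≥0∞) :
    MemLp (uncurry (gradN g n)) r volume :=
  (isSpaceTimeTestOn_gradN_top hg hp hgs n).contDiff.continuous.memLp_of_hasCompactSupport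
    (isSpaceTimeTestOn_gradN_top hg hp hgs n).hasCompactSupport

/-- The mollified field, uncurried slices, is in every `L^r`. [folklore] -/
theorem memLp_moll (hg : MemLp g p volume) (hp : 1 ≤ p)
    (hgs : support g ⊆ parabolicCylinder 1 z₀) (n : ℕ) (r : ℝ≥0∞) :
    MemLp (moll n g) r volume :=
  (contDiff_moll hg hp n).continuous.memLp_of_hasCompactSupport (hasCompactSupport_moll hgs n)

/-! #### Slice bounds for differences, and their space–time integrals -/

/-- Linearity of the construction in the level `n`: `πₙ(t) - πₘ(t) = P[gₙ(t) - gₘ(t)]`.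
[folklore] -/
theorem piN_sub (hg : MemLp g p volume) (hp : 1 ≤ p) (n m : ℕ) (t : ℝ) :
    (fun x => piN g n t x - piN g m t x) = potential (slice g n t - slice g m t) := by
  rw [potential_sub (contDiff_infty.1 (contDiff_slice hg hp n t) 1)
    (contDiff_infty.1 (contDiff_slice hg hp m t) 1)]
  rfl

/-- `𝒢ₙ(t) - 𝒢ₘ(t) = ∇P[gₙ(t) - gₘ(t)]`. [folklore] -/
theorem gradN_sub (hg : MemLp g p volume) (hp : 1 ≤ p) (n m : ℕ) (t : ℝ) :
    (fun x => gradN g n t x - gradN g m t x) = gradient (potential (slice g n t - slice g m t)) := by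
  rw [← piN_sub hg hp n m t]
  funext x
  have hdn : DifferentiableAt ℝ (piN g n t) x :=
    ((contDiff_infty.1 (contDiff_potential (contDiff_slice hg hp n t)) 1).differentiable
      one_ne_zero) x
  have hdm : DifferentiableAt ℝ (piN g m t) x :=
    ((contDiff_infty.1 (contDiff_potential (contDiff_slice hg hp m t)) 1).differentiable
      one_ne_zero) x
  simp only [gradN, gradient, fderiv_fun_sub hdn hdm, map_sub]

/-- The difference of two slices is smooth, compactly supported, supported in `B(x₀, 2)`.
[folklore] -/
theorem slice_sub_props (hg : MemLp g p volume) (hp : 1 ≤ p)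
    (hgs : support g ⊆ parabolicCylinder 1 z₀) (n m : ℕ) (t : ℝ) :
    ContDiff ℝ ∞ (slice g n t - slice g m t) ∧ HasCompactSupport (slice g n t - slice g m t) ∧
      tsupport (slice g n t - slice g m t) ⊆ ball z₀.2 2 := by
  refine ⟨(contDiff_slice hg hp n t).sub (contDiff_slice hg hp m t),
    (hasCompactSupport_slice hgs n t).sub (hasCompactSupport_slice hgs m t), ?_⟩
  calc tsupport (slice g n t - slice g m t)
      ⊆ closure (support (slice g n t) ∪ support (slice g m t)) :=
        closure_mono (support_sub _ _)
    _ = tsupport (slice g n t) ∪ tsupport (slice g m t) := closure_union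
    _ ⊆ ball z₀.2 2 :=
        union_subset (tsupport_slice_subset hgs n t) (tsupport_slice_subset hgs m t)

end Smooth

/-! ### Pairings with bounded compactly supported fields pass to `L^p` limits -/

section Pairing

variable {X : Type*} [MeasurableSpace X] {μ : Measure X} {E₁ E₂ : Type*}
  [NormedAddCommGroup E₁] [NormedSpace ℝ E₁] [NormedAddCommGroup E₂] [NormedSpace ℝ E₂]

/-- A bilinear pairing of an `L^p` field (`1 ≤ p`) with a bounded field vanishing off a set of
finite measure is integrable. [folklore] -/
theorem integrable_bilin_of_memLp_of_bdd (β : E₁ →L[ℝ] E₂ →L[ℝ] ℝ) {p : ℝ≥0∞} (hp : 1 ≤ p)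
    {A : X → E₁} (hA : MemLp A p μ) {Ψ : X → E₂} (hΨ : AEStronglyMeasurable Ψ μ) {C : ℝ}
    (hC : ∀ x, ‖Ψ x‖ ≤ C) {S : Set X} (hμS : μ S ≠ ⊤)
    (hΨS : ∀ x, x ∉ S → Ψ x = 0) : Integrable (fun x => β (A x) (Ψ x)) μ := by
  have hsupp : support (fun x => β (A x) (Ψ x)) ⊆ S := by
    intro x hx
    by_contra h
    exact hx (by simp [hΨS x h])
  rw [← integrableOn_iff_integrable_of_support_subset hsupp]
  have hA1 : Integrable A (μ.restrict S) := by
    haveI : IsFiniteMeasure (μ.restrict S) := ⟨by rwa [Measure.restrict_apply_univ, lt_top_iff_ne_top]⟩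
    exact memLp_one_iff_integrable.1 ((hA.restrict S).mono_exponent hp)
  refine (hA1.norm.const_mul (‖β‖ * C)).mono' ?_ (Eventually.of_forall fun x => ?_)
  · exact β.continuous₂.comp_aestronglyMeasurable (hA.1.restrict.prodMk hΨ.restrict)
  · calc ‖β (A x) (Ψ x)‖ ≤ ‖β‖ * ‖A x‖ * ‖Ψ x‖ := β.le_opNorm₂ _ _
      _ ≤ ‖β‖ * ‖A x‖ * C := by gcongr; exact hC x
      _ = ‖β‖ * C * ‖A x‖ := by ring

/-- **Pairings pass to `L^p` limits.** If `Aₙ → A` in `L^p(μ)` (`1 ≤ p`) and `Ψ` is a bounded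
measurable field vanishing off a set `S` of finite measure, then
`∫ β(Aₙ, Ψ) → ∫ β(A, Ψ)` for every bounded bilinear pairing `β` (Hölder on `S`). [folklore] -/
theorem tendsto_integral_bilin_of_tendsto_eLpNorm (β : E₁ →L[ℝ] E₂ →L[ℝ] ℝ) {p : ℝ≥0∞}
    (hp : 1 ≤ p) {A : ℕ → X → E₁} {A₀ : X → E₁} (hA : ∀ n, MemLp (A n) p μ) (hA₀ : MemLp A₀ p μ)
    (h : Tendsto (fun n => eLpNorm (A n - A₀) p μ) atTop (𝓝 0))
    {Ψ : X → E₂} (hΨ : AEStronglyMeasurable Ψ μ) {C : ℝ} (hC : ∀ x, ‖Ψ x‖ ≤ C)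
    {S : Set X} (hS : MeasurableSet S) (hμS : μ S ≠ ⊤) (hΨS : ∀ x, x ∉ S → Ψ x = 0) :
    Tendsto (fun n => ∫ x, β (A n x) (Ψ x) ∂μ) atTop (𝓝 (∫ x, β (A₀ x) (Ψ x) ∂μ)) := by
  refine tendsto_integral_of_L1 _ (integrable_bilin_of_memLp_of_bdd β hp hA₀ hΨ hC hμS hΨS).1
    (Eventually.of_forall fun n => integrable_bilin_of_memLp_of_bdd β hp (hA n) hΨ hC hμS hΨS)
    ?_
  -- the `L¹` distance is controlled by the `L^p` distance on `S`
  set K : ℝ≥0∞ := ENNReal.ofReal (‖β‖ * C) with hK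
  set M : ℝ≥0∞ := μ S ^ (1 / (1 : ℝ≥0∞).toReal - 1 / p.toReal) with hM
  have hMtop : M ≠ ⊤ := by
    rw [hM]
    refine ENNReal.rpow_ne_top_of_nonneg ?_ hμS
    rw [ENNReal.toReal_one, div_one, sub_nonneg]
    rcases eq_or_ne p ⊤ with hpt | hpt
    · rw [hpt, ENNReal.toReal_top, div_zero]; exact zero_le_one
    · rw [div_le_one (ENNReal.toReal_pos (zero_lt_one.trans_le hp).ne' hpt)]
      have := (ENNReal.toReal_le_toReal ENNReal.one_ne_top hpt).2 hp
      rwa [ENNReal.toReal_one] at this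
  have hbound : ∀ n, ∫⁻ x, ‖β (A n x) (Ψ x) - β (A₀ x) (Ψ x)‖ₑ ∂μ ≤
      K * (eLpNorm (A n - A₀) p μ * M) := by
    intro n
    have hpt : ∀ x, ‖β (A n x) (Ψ x) - β (A₀ x) (Ψ x)‖ₑ ≤
        S.indicator (fun x => K * ‖(A n - A₀) x‖ₑ) x := by
      intro x
      by_cases hx : x ∈ S
      · have hC0 : 0 ≤ C := (norm_nonneg _).trans (hC x)
        rw [indicator_of_mem hx, ← _root_.sub_apply, ← map_sub,
          ← ofReal_norm, ← ofReal_norm, hK,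
          ← ENNReal.ofReal_mul (by positivity)]
        refine ENNReal.ofReal_le_ofReal ?_
        calc ‖β (A n x - A₀ x) (Ψ x)‖ ≤ ‖β‖ * ‖A n x - A₀ x‖ * ‖Ψ x‖ := β.le_opNorm₂ _ _
          _ ≤ ‖β‖ * ‖A n x - A₀ x‖ * C := by gcongr; exact hC x
          _ = ‖β‖ * C * ‖(A n - A₀) x‖ := by rw [Pi.sub_apply]; ring
      · rw [indicator_of_notMem hx, hΨS x hx, map_zero, map_zero, sub_zero, enorm_zero]
    calc ∫⁻ x, ‖β (A n x) (Ψ x) - β (A₀ x) (Ψ x)‖ₑ ∂μ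
        ≤ ∫⁻ x, S.indicator (fun x => K * ‖(A n - A₀) x‖ₑ) x ∂μ := lintegral_mono hpt
      _ = K * ∫⁻ x in S, ‖(A n - A₀) x‖ₑ ∂μ := by
          rw [lintegral_indicator hS, lintegral_const_mul' _ _ ENNReal.ofReal_ne_top]
      _ = K * eLpNorm (A n - A₀) 1 (μ.restrict S) := by rw [eLpNorm_one_eq_lintegral_enorm]
      _ ≤ K * (eLpNorm (A n - A₀) p (μ.restrict S) * M) := by
          gcongr
          have := eLpNorm_le_eLpNorm_mul_rpow_measure_univ hp
            (((hA n).sub hA₀).1.restrict (s := S)) (μ := μ.restrict S)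
          rwa [Measure.restrict_apply_univ] at this
      _ ≤ K * (eLpNorm (A n - A₀) p μ * M) := by
          gcongr
          exact Measure.restrict_le_self
  have hlim : Tendsto (fun n => K * (eLpNorm (A n - A₀) p μ * M)) atTop (𝓝 0) := by
    have h1 : Tendsto (fun n => eLpNorm (A n - A₀) p μ * M) atTop (𝓝 (0 * M)) :=
      ENNReal.Tendsto.mul_const h (Or.inr hMtop)
    rw [zero_mul] at h1
    have h2 := ENNReal.Tendsto.const_mul (a := K) h1 (Or.inr (by rw [hK]; exact ENNReal.ofReal_ne_top))
    rwa [mul_zero] at h2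
  exact tendsto_of_tendsto_of_tendsto_of_le_of_le tendsto_const_nhds hlim (fun n => zero_le)
    hbound

end Pairing

/-! ### Space–time bounds at the smooth level -/

section Bounds

/-- The exponent `3/2`, in the coerced form of `LocalHelmholtzSlice`. -/
local notation "p₃₂" => ((3 / 2 : ℝ≥0) : ℝ≥0∞)

/-- `1 < 3/2`. [folklore] -/
theorem one_lt_p32 : (1 : ℝ≥0∞) < p₃₂ := by
  have : (1 : ℝ≥0) < 3 / 2 := by rw [← NNReal.coe_lt_coe]; push_cast; norm_num
  exact_mod_cast this

/-- `3/2 < ∞`. [folklore] -/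
theorem p32_lt_top : p₃₂ < ⊤ := ENNReal.coe_lt_top

variable {z₀ : ℝ × ℝ³} {g : ℝ × ℝ³ → ℝ³} {p : ℝ≥0∞}

/-- **`‖𝒢ₙ - 𝒢ₘ‖_{L^p(ℝ × ℝ³)} ≤ C_p ‖gₙ - gₘ‖_{L^p(ℝ × ℝ³)}`** (slice Calderón–Zygmund bound and
Tonelli). [folklore] -/
theorem eLpNorm_gradN_sub_le (hg : MemLp g p volume) (hp : 1 < p) (hp' : p < ⊤)
    (hgs : support g ⊆ parabolicCylinder 1 z₀) {Cg : ℝ≥0}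
    (hCg : ∀ ⦃w : ℝ³ → ℝ³⦄, ContDiff ℝ ∞ w → HasCompactSupport w →
      eLpNorm (gradient (potential w)) p volume ≤ Cg * eLpNorm w p volume) (n m : ℕ) :
    eLpNorm (uncurry (gradN g n) - uncurry (gradN g m)) p volume ≤
      Cg * eLpNorm (moll n g - moll m g) p volume := by
  rw [Measure.volume_eq_prod]
  refine eLpNorm_prod_le_of_slice_le ?_ ?_ (zero_lt_one.trans hp).ne' hp'.ne fun t => ?_
  · rw [← Measure.volume_eq_prod]
    exact ((isSpaceTimeTestOn_gradN_top hg hp.le hgs n).contDiff.continuous.sub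
      (isSpaceTimeTestOn_gradN_top hg hp.le hgs m).contDiff.continuous).aestronglyMeasurable
  · rw [← Measure.volume_eq_prod]
    exact ((contDiff_moll hg hp.le n).continuous.sub
      (contDiff_moll hg hp.le m).continuous).aestronglyMeasurable
  · obtain ⟨h1, h2, -⟩ := slice_sub_props hg hp.le hgs n m t
    have e : (fun y => (uncurry (gradN g n) - uncurry (gradN g m)) (t, y)) =
        gradient (potential (slice g n t - slice g m t)) := by
      rw [← gradN_sub hg hp.le n m t]; rfl
    rw [e]
    exact hCg h1 h2

/-- `‖𝒢ₙ‖_{L^p(ℝ × ℝ³)} ≤ C_p ‖gₙ‖_{L^p(ℝ × ℝ³)}`. [folklore] -/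
theorem eLpNorm_gradN_le (hg : MemLp g p volume) (hp : 1 < p) (hp' : p < ⊤)
    (hgs : support g ⊆ parabolicCylinder 1 z₀) {Cg : ℝ≥0}
    (hCg : ∀ ⦃w : ℝ³ → ℝ³⦄, ContDiff ℝ ∞ w → HasCompactSupport w →
      eLpNorm (gradient (potential w)) p volume ≤ Cg * eLpNorm w p volume) (n : ℕ) :
    eLpNorm (uncurry (gradN g n)) p volume ≤ Cg * eLpNorm (moll n g) p volume := by
  rw [Measure.volume_eq_prod]
  refine eLpNorm_prod_le_of_slice_le ?_ ?_ (zero_lt_one.trans hp).ne' hp'.ne fun t => ?_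
  · rw [← Measure.volume_eq_prod]
    exact (isSpaceTimeTestOn_gradN_top hg hp.le hgs n).contDiff.continuous.aestronglyMeasurable
  · rw [← Measure.volume_eq_prod]
    exact (contDiff_moll hg hp.le n).continuous.aestronglyMeasurable
  · have e : (fun y => uncurry (gradN g n) (t, y)) = gradient (potential (slice g n t)) := rfl
    rw [e]
    exact hCg (contDiff_slice hg hp.le n t) (hasCompactSupport_slice hgs n t)

/-- **`‖πₙ - πₘ‖_{L^{3/2}(ℝ × ℝ³)} ≤ C ‖gₙ - gₘ‖_{L^{3/2}(ℝ × ℝ³)}`**. [folklore] -/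
theorem eLpNorm_piN_sub_le (hg : MemLp g p volume) (hp : 1 ≤ p)
    (hgs : support g ⊆ parabolicCylinder 1 z₀) {Cπ : ℝ≥0}
    (hCπ : ∀ (c : ℝ³) ⦃w : ℝ³ → ℝ³⦄, ContDiff ℝ ∞ w → HasCompactSupport w →
      tsupport w ⊆ ball c 2 → eLpNorm (potential w) p₃₂ volume ≤ Cπ * eLpNorm w p₃₂ volume)
    (n m : ℕ) :
    eLpNorm (uncurry (piN g n) - uncurry (piN g m)) p₃₂ volume ≤
      Cπ * eLpNorm (moll n g - moll m g) p₃₂ volume := by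
  rw [Measure.volume_eq_prod]
  refine eLpNorm_prod_le_of_slice_le ?_ ?_ (zero_lt_one.trans one_lt_p32).ne' p32_lt_top.ne
    fun t => ?_
  · rw [← Measure.volume_eq_prod]
    exact ((isSpaceTimeTestOn_piN_top hg hp hgs n).contDiff.continuous.sub
      (isSpaceTimeTestOn_piN_top hg hp hgs m).contDiff.continuous).aestronglyMeasurable
  · rw [← Measure.volume_eq_prod]
    exact ((contDiff_moll hg hp n).continuous.sub
      (contDiff_moll hg hp m).continuous).aestronglyMeasurable
  · obtain ⟨h1, h2, h3⟩ := slice_sub_props hg hp hgs n m t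
    have e : (fun y => (uncurry (piN g n) - uncurry (piN g m)) (t, y)) =
        potential (slice g n t - slice g m t) := by
      rw [← piN_sub hg hp n m t]; rfl
    rw [e]
    exact hCπ z₀.2 h1 h2 h3

/-- `‖πₙ‖_{L^{3/2}(ℝ × ℝ³)} ≤ C ‖gₙ‖_{L^{3/2}(ℝ × ℝ³)}`. [folklore] -/
theorem eLpNorm_piN_le (hg : MemLp g p volume) (hp : 1 ≤ p)
    (hgs : support g ⊆ parabolicCylinder 1 z₀) {Cπ : ℝ≥0}
    (hCπ : ∀ (c : ℝ³) ⦃w : ℝ³ → ℝ³⦄, ContDiff ℝ ∞ w → HasCompactSupport w →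
      tsupport w ⊆ ball c 2 → eLpNorm (potential w) p₃₂ volume ≤ Cπ * eLpNorm w p₃₂ volume)
    (n : ℕ) :
    eLpNorm (uncurry (piN g n)) p₃₂ volume ≤ Cπ * eLpNorm (moll n g) p₃₂ volume := by
  rw [Measure.volume_eq_prod]
  refine eLpNorm_prod_le_of_slice_le ?_ ?_ (zero_lt_one.trans one_lt_p32).ne' p32_lt_top.ne
    fun t => ?_
  · rw [← Measure.volume_eq_prod]
    exact (isSpaceTimeTestOn_piN_top hg hp hgs n).contDiff.continuous.aestronglyMeasurable
  · rw [← Measure.volume_eq_prod]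
    exact (contDiff_moll hg hp n).continuous.aestronglyMeasurable
  · have e : (fun y => uncurry (piN g n) (t, y)) = potential (slice g n t) := rfl
    rw [e]
    exact hCπ z₀.2 (contDiff_slice hg hp n t) (hasCompactSupport_slice hgs n t)
      (tsupport_slice_subset hgs n t)

/-! ### A fast subsequence and the limits `π`, `𝒢` -/

/-- Along a subsequence, `gₙ → g` with geometric rate both in `L^p` and in `L^{3/2}`.
[folklore] -/
theorem exists_fast_subseq (hg : MemLp g p volume) (hg' : MemLp g p₃₂ volume) (hp : 1 ≤ p)
    (hp' : p ≠ ⊤) :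
    ∃ φ : ℕ → ℕ, StrictMono φ ∧ ∀ k, eLpNorm (moll (φ k) g - g) p volume < 2⁻¹ ^ k ∧
      eLpNorm (moll (φ k) g - g) p₃₂ volume < 2⁻¹ ^ k := by
  refine extraction_forall_of_eventually (P := fun k m => eLpNorm (moll m g - g) p volume < 2⁻¹ ^ k ∧
    eLpNorm (moll m g - g) p₃₂ volume < 2⁻¹ ^ k) fun k => ?_
  have hε : (0 : ℝ≥0∞) < 2⁻¹ ^ k := ENNReal.pow_pos (by norm_num) k
  exact ((tendsto_eLpNorm_moll_sub hg hp hp').eventually (gt_mem_nhds hε)).and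
    ((tendsto_eLpNorm_moll_sub hg' one_lt_p32.le p32_lt_top.ne).eventually (gt_mem_nhds hε))

/-- The summable Cauchy modulus `(2C + 1) 2⁻ᵏ`. [folklore] -/
theorem tsum_modulus_ne_top (C : ℝ≥0) :
    ∑' k : ℕ, (2 * (C : ℝ≥0∞) * 2⁻¹ ^ k + 2⁻¹ ^ k) ≠ ⊤ := by
  have hgeo : ∑' k : ℕ, (2⁻¹ : ℝ≥0∞) ^ k = 2 := by
    rw [ENNReal.tsum_geometric, ENNReal.one_sub_inv_two, inv_inv]
  rw [ENNReal.tsum_add, ENNReal.tsum_mul_left, hgeo]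
  exact ENNReal.add_ne_top.2 ⟨ENNReal.mul_ne_top (ENNReal.mul_ne_top (by norm_num)
    ENNReal.coe_ne_top) (by norm_num), by norm_num⟩

end Bounds

/-! ### The limits `π`, `𝒢` and their properties -/

section Limits

/-- The exponent `3/2`, in the coerced form of `LocalHelmholtzSlice`. -/
local notation "p₃₂" => ((3 / 2 : ℝ≥0) : ℝ≥0∞)

variable {z₀ : ℝ × ℝ³} {g : ℝ × ℝ³ → ℝ³} {p : ℝ≥0∞}

/-- The unit parabolic cylinder has finite measure. [folklore] -/
theorem volume_parabolicCylinder_one_ne_top (z₀ : ℝ × ℝ³) :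
    volume (parabolicCylinder 1 z₀) ≠ ⊤ :=
  ((measure_mono subset_closure).trans_lt
    (isCompact_closure_parabolicCylinder_one z₀).measure_lt_top).ne

/-- `g ∈ L^{3/2}` for `g ∈ L^p`, `p ≥ 3/2`, supported in `Q₁`. [folklore] -/
theorem memLp_p32_of_memLp (hg : MemLp g p volume) (hp : p₃₂ ≤ p)
    (hgs : support g ⊆ parabolicCylinder 1 z₀) : MemLp g p₃₂ volume :=
  hg.mono_exponent_of_measure_support_ne_top (s := parabolicCylinder 1 z₀)
    (fun x hx => by by_contra h; exact hx (hgs h)) (volume_parabolicCylinder_one_ne_top z₀) hp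

/-- `2⁻ᵏ ≤ 2⁻ᴺ` for `N ≤ k` in `ℝ≥0∞`. [folklore] -/
theorem half_pow_le_half_pow {N k : ℕ} (h : N ≤ k) : (2⁻¹ : ℝ≥0∞) ^ k ≤ 2⁻¹ ^ N :=
  pow_le_pow_right_of_le_one' (ENNReal.inv_le_one.2 one_le_two) h

/-- The Cauchy estimate along the fast subsequence. [folklore] -/
theorem cauchy_estimate {F : ℕ → ℝ × ℝ³ → ℝ³} {r : ℝ≥0∞} {C : ℝ≥0} {a : ℕ → ℝ≥0∞}
    (hF : ∀ n m, eLpNorm (F n - F m) r volume ≤ C * (a n + a m))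
    (ha : ∀ k, a k < 2⁻¹ ^ k) (N n m : ℕ) (hn : N ≤ n) (hm : N ≤ m) :
    eLpNorm (F n - F m) r volume < 2 * (C : ℝ≥0∞) * 2⁻¹ ^ N + 2⁻¹ ^ N := by
  have hN : (2⁻¹ : ℝ≥0∞) ^ N ≠ ⊤ := ENNReal.pow_ne_top (ENNReal.inv_ne_top.2 two_ne_zero)
  calc eLpNorm (F n - F m) r volume ≤ C * (a n + a m) := hF n m
    _ ≤ C * (2⁻¹ ^ N + 2⁻¹ ^ N) := by
        gcongr
        · exact (ha n).le.trans (half_pow_le_half_pow hn)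
        · exact (ha m).le.trans (half_pow_le_half_pow hm)
    _ = 2 * (C : ℝ≥0∞) * 2⁻¹ ^ N := by ring
    _ < 2 * (C : ℝ≥0∞) * 2⁻¹ ^ N + 2⁻¹ ^ N :=
        ENNReal.lt_add_right (ENNReal.mul_ne_top (ENNReal.mul_ne_top (by norm_num)
          ENNReal.coe_ne_top) hN) (ENNReal.pow_pos (by norm_num) N).ne'

/-- The same estimate for scalar fields. [folklore] -/
theorem cauchy_estimate' {F : ℕ → ℝ × ℝ³ → ℝ} {r : ℝ≥0∞} {C : ℝ≥0} {a : ℕ → ℝ≥0∞}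
    (hF : ∀ n m, eLpNorm (F n - F m) r volume ≤ C * (a n + a m))
    (ha : ∀ k, a k < 2⁻¹ ^ k) (N n m : ℕ) (hn : N ≤ n) (hm : N ≤ m) :
    eLpNorm (F n - F m) r volume < 2 * (C : ℝ≥0∞) * 2⁻¹ ^ N + 2⁻¹ ^ N := by
  have hN : (2⁻¹ : ℝ≥0∞) ^ N ≠ ⊤ := ENNReal.pow_ne_top (ENNReal.inv_ne_top.2 two_ne_zero)
  calc eLpNorm (F n - F m) r volume ≤ C * (a n + a m) := hF n m
    _ ≤ C * (2⁻¹ ^ N + 2⁻¹ ^ N) := by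
        gcongr
        · exact (ha n).le.trans (half_pow_le_half_pow hn)
        · exact (ha m).le.trans (half_pow_le_half_pow hm)
    _ = 2 * (C : ℝ≥0∞) * 2⁻¹ ^ N := by ring
    _ < 2 * (C : ℝ≥0∞) * 2⁻¹ ^ N + 2⁻¹ ^ N :=
        ENNReal.lt_add_right (ENNReal.mul_ne_top (ENNReal.mul_ne_top (by norm_num)
          ENNReal.coe_ne_top) hN) (ENNReal.pow_pos (by norm_num) N).ne'

/-- `‖(aₙ - aₘ)‖ ≤ ‖aₙ - g‖ + ‖aₘ - g‖` in `L^r`. [folklore] -/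
theorem eLpNorm_sub_le_of_sub_sub {F' : Type*} [NormedAddCommGroup F'] {u v w : ℝ × ℝ³ → F'}
    {r : ℝ≥0∞} (hr : 1 ≤ r) (hu : AEStronglyMeasurable u volume)
    (hv : AEStronglyMeasurable v volume) (hw : AEStronglyMeasurable w volume) :
    eLpNorm (u - v) r volume ≤ eLpNorm (u - w) r volume + eLpNorm (v - w) r volume := by
  have : u - v = (u - w) - (v - w) := by abel
  rw [this]
  exact eLpNorm_sub_le (hu.sub hw) (hv.sub hw) hr

/-- **Existence of the limits.** Along a fast subsequence `φ`, `π_{φ k} → π` in `L^{3/2}` and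
`𝒢_{φ k} → 𝒢` in `L^p` for some `π ∈ L^{3/2}`, `𝒢 ∈ L^p` (Cauchy with summable rate, Riesz–Fischer).
[folklore] -/
theorem exists_limits (hg : MemLp g p volume) (hp : p₃₂ ≤ p) (hp' : p < ⊤)
    (hgs : support g ⊆ parabolicCylinder 1 z₀) {Cg : ℝ≥0}
    (hCg : ∀ ⦃w : ℝ³ → ℝ³⦄, ContDiff ℝ ∞ w → HasCompactSupport w →
      eLpNorm (gradient (potential w)) p volume ≤ Cg * eLpNorm w p volume) {Cπ : ℝ≥0}
    (hCπ : ∀ (c : ℝ³) ⦃w : ℝ³ → ℝ³⦄, ContDiff ℝ ∞ w → HasCompactSupport w →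
      tsupport w ⊆ ball c 2 → eLpNorm (potential w) p₃₂ volume ≤ Cπ * eLpNorm w p₃₂ volume) :
    ∃ (φ : ℕ → ℕ) (π : ℝ × ℝ³ → ℝ) (𝒢 : ℝ × ℝ³ → ℝ³), StrictMono φ ∧
      MemLp π p₃₂ volume ∧ MemLp 𝒢 p volume ∧
      Tendsto (fun k => eLpNorm (uncurry (piN g (φ k)) - π) p₃₂ volume) atTop (𝓝 0) ∧
      Tendsto (fun k => eLpNorm (uncurry (gradN g (φ k)) - 𝒢) p volume) atTop (𝓝 0) ∧
      Tendsto (fun k => eLpNorm (moll (φ k) g - g) p volume) atTop (𝓝 0) ∧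
      Tendsto (fun k => eLpNorm (moll (φ k) g - g) p₃₂ volume) atTop (𝓝 0) := by
  have hp1 : 1 < p := one_lt_p32.trans_le hp
  have hg' : MemLp g p₃₂ volume := memLp_p32_of_memLp hg hp hgs
  obtain ⟨φ, hφ, hφk⟩ := exists_fast_subseq hg hg' hp1.le hp'.ne
  -- the gradients
  have hmG : ∀ k, AEStronglyMeasurable (moll (φ k) g) volume := fun k =>
    (contDiff_moll hg hp1.le (φ k)).continuous.aestronglyMeasurable
  have hcauG := cauchy_estimate (F := fun k => uncurry (gradN g (φ k))) (r := p) (C := Cg)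
    (a := fun k => eLpNorm (moll (φ k) g - g) p volume) (fun n m =>
      (eLpNorm_gradN_sub_le hg hp1 hp' hgs hCg (φ n) (φ m)).trans (mul_le_mul_right
        (eLpNorm_sub_le_of_sub_sub hp1.le (hmG n) (hmG m) hg.1) _)) (fun k => (hφk k).1)
  obtain ⟨𝒢, h𝒢, ht𝒢⟩ := MeasureTheory.Lp.cauchy_complete_eLpNorm (μ := volume) hp1.le
    (fun k => memLp_gradN hg hp1.le hgs (φ k) p) (tsum_modulus_ne_top Cg) hcauG
  -- the potentials
  have hcauP := cauchy_estimate' (F := fun k => uncurry (piN g (φ k))) (r := p₃₂) (C := Cπ)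
    (a := fun k => eLpNorm (moll (φ k) g - g) p₃₂ volume) (fun n m =>
      (eLpNorm_piN_sub_le hg hp1.le hgs hCπ (φ n) (φ m)).trans (mul_le_mul_right
        (eLpNorm_sub_le_of_sub_sub one_lt_p32.le (hmG n) (hmG m) hg.1) _)) (fun k => (hφk k).2)
  obtain ⟨π, hπ, htπ⟩ := MeasureTheory.Lp.cauchy_complete_eLpNorm (μ := volume) one_lt_p32.le
    (fun k => memLp_piN hg hp1.le hgs (φ k) p₃₂) (tsum_modulus_ne_top Cπ) hcauP
  -- the mollified fields along the subsequence
  have hhalf : Tendsto (fun k : ℕ => (2⁻¹ : ℝ≥0∞) ^ k) atTop (𝓝 0) :=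
    ENNReal.tendsto_pow_atTop_nhds_zero_of_lt_one (by norm_num)
  refine ⟨φ, π, 𝒢, hφ, hπ, h𝒢, htπ, ht𝒢, ?_, ?_⟩
  · exact tendsto_of_tendsto_of_tendsto_of_le_of_le tendsto_const_nhds hhalf (fun k => zero_le)
      fun k => (hφk k).1.le
  · exact tendsto_of_tendsto_of_tendsto_of_le_of_le tendsto_const_nhds hhalf (fun k => zero_le)
      fun k => (hφk k).2.le

/-- **The `L^p` bound passes to the limit**: `‖𝒢‖_{L^p} ≤ C_p ‖g‖_{L^p}`. [folklore] -/
theorem eLpNorm_limitG_le (hg : MemLp g p volume) (hp : p₃₂ ≤ p) (hp' : p < ⊤)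
    (hgs : support g ⊆ parabolicCylinder 1 z₀) {Cg : ℝ≥0}
    (hCg : ∀ ⦃w : ℝ³ → ℝ³⦄, ContDiff ℝ ∞ w → HasCompactSupport w →
      eLpNorm (gradient (potential w)) p volume ≤ Cg * eLpNorm w p volume)
    {φ : ℕ → ℕ} {𝒢 : ℝ × ℝ³ → ℝ³} (h𝒢 : MemLp 𝒢 p volume)
    (ht : Tendsto (fun k => eLpNorm (uncurry (gradN g (φ k)) - 𝒢) p volume) atTop (𝓝 0)) :
    eLpNorm 𝒢 p volume ≤ Cg * eLpNorm g p volume := by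
  have hp1 : 1 < p := one_lt_p32.trans_le hp
  have key : ∀ k, eLpNorm 𝒢 p volume ≤
      eLpNorm (uncurry (gradN g (φ k)) - 𝒢) p volume + Cg * eLpNorm g p volume := by
    intro k
    have hm := (memLp_gradN hg hp1.le hgs (φ k) p).1
    calc eLpNorm 𝒢 p volume
        ≤ eLpNorm (𝒢 - uncurry (gradN g (φ k))) p volume +
            eLpNorm (uncurry (gradN g (φ k))) p volume := by
          have := eLpNorm_add_le (h𝒢.1.sub hm) hm hp1.le (μ := volume)
          rwa [sub_add_cancel] at this
      _ ≤ eLpNorm (uncurry (gradN g (φ k)) - 𝒢) p volume + Cg * eLpNorm g p volume := by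
          rw [eLpNorm_sub_comm]
          gcongr
          exact (eLpNorm_gradN_le hg hp1 hp' hgs hCg (φ k)).trans
            (mul_le_mul_right (eLpNorm_moll_le hg.1 hp1.le _) _)
  have hlim : Tendsto (fun k => eLpNorm (uncurry (gradN g (φ k)) - 𝒢) p volume +
      Cg * eLpNorm g p volume) atTop (𝓝 (0 + Cg * eLpNorm g p volume)) :=
    ht.add tendsto_const_nhds
  rw [zero_add] at hlim
  exact ge_of_tendsto' hlim key

/-- **The `L^{3/2}` bound passes to the limit**: `‖π‖_{L^{3/2}} ≤ C ‖g‖_{L^{3/2}}`. [folklore] -/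
theorem eLpNorm_limitP_le (hg : MemLp g p volume) (hp : p₃₂ ≤ p)
    (hgs : support g ⊆ parabolicCylinder 1 z₀) {Cπ : ℝ≥0}
    (hCπ : ∀ (c : ℝ³) ⦃w : ℝ³ → ℝ³⦄, ContDiff ℝ ∞ w → HasCompactSupport w →
      tsupport w ⊆ ball c 2 → eLpNorm (potential w) p₃₂ volume ≤ Cπ * eLpNorm w p₃₂ volume)
    {φ : ℕ → ℕ} {π : ℝ × ℝ³ → ℝ} (hπ : MemLp π p₃₂ volume)
    (ht : Tendsto (fun k => eLpNorm (uncurry (piN g (φ k)) - π) p₃₂ volume) atTop (𝓝 0)) :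
    eLpNorm π p₃₂ volume ≤ Cπ * eLpNorm g p₃₂ volume := by
  have hp1 : 1 < p := one_lt_p32.trans_le hp
  have key : ∀ k, eLpNorm π p₃₂ volume ≤
      eLpNorm (uncurry (piN g (φ k)) - π) p₃₂ volume + Cπ * eLpNorm g p₃₂ volume := by
    intro k
    have hm := (memLp_piN hg hp1.le hgs (φ k) p₃₂).1
    calc eLpNorm π p₃₂ volume
        ≤ eLpNorm (π - uncurry (piN g (φ k))) p₃₂ volume +
            eLpNorm (uncurry (piN g (φ k))) p₃₂ volume := by
          have := eLpNorm_add_le (hπ.1.sub hm) hm one_lt_p32.le (μ := volume)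
          rwa [sub_add_cancel] at this
      _ ≤ eLpNorm (uncurry (piN g (φ k)) - π) p₃₂ volume + Cπ * eLpNorm g p₃₂ volume := by
          rw [eLpNorm_sub_comm]
          gcongr
          exact (eLpNorm_piN_le hg hp1.le hgs hCπ (φ k)).trans
            (mul_le_mul_right (eLpNorm_moll_le hg.1 one_lt_p32.le _) _)
  have hlim : Tendsto (fun k => eLpNorm (uncurry (piN g (φ k)) - π) p₃₂ volume +
      Cπ * eLpNorm g p₃₂ volume) atTop (𝓝 (0 + Cπ * eLpNorm g p₃₂ volume)) :=
    ht.add tendsto_const_nhds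
  rw [zero_add] at hlim
  exact ge_of_tendsto' hlim key

/-- **`𝒢 = ∇ₓπ` weakly**: `∫∫ π div ψ = -∫∫ ⟪𝒢, ψ⟫` for every vector test field `ψ` on `ℝ × ℝ³`
(slicewise integration by parts at the smooth level, then the pairings pass to the limit).
[folklore] -/
theorem integral_limitP_mul_divergence (hg : MemLp g p volume) (hp : p₃₂ ≤ p)
    (hgs : support g ⊆ parabolicCylinder 1 z₀) {φ : ℕ → ℕ} {π : ℝ × ℝ³ → ℝ}
    {𝒢 : ℝ × ℝ³ → ℝ³} (hπ : MemLp π p₃₂ volume) (h𝒢 : MemLp 𝒢 p volume)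
    (htπ : Tendsto (fun k => eLpNorm (uncurry (piN g (φ k)) - π) p₃₂ volume) atTop (𝓝 0))
    (ht𝒢 : Tendsto (fun k => eLpNorm (uncurry (gradN g (φ k)) - 𝒢) p volume) atTop (𝓝 0))
    {ψ : ℝ → ℝ³ → ℝ³} (hψ : IsSpaceTimeTestOn (⊤ : Opens (ℝ × ℝ³)) ψ) :
    ∫ z, π z * VectorCalculus.divergence (ψ z.1) z.2 = -∫ z, ⟪𝒢 z, ψ z.1 z.2⟫ := by
  have hp1 : 1 < p := one_lt_p32.trans_le hp
  have hdiv := isSpaceTimeTestOn_divergence hψ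
  -- the identity at the smooth level
  have hk : ∀ k, ∫ z, uncurry (piN g (φ k)) z * VectorCalculus.divergence (ψ z.1) z.2 =
      -∫ z, ⟪uncurry (gradN g (φ k)) z, ψ z.1 z.2⟫ := by
    intro k
    have hP := isSpaceTimeTestOn_piN_top hg hp1.le hgs (φ k)
    have hG := isSpaceTimeTestOn_gradN_top hg hp1.le hgs (φ k)
    have hI1 : Integrable (fun z : ℝ × ℝ³ =>
        uncurry (piN g (φ k)) z * VectorCalculus.divergence (ψ z.1) z.2) volume :=
      (hP.contDiff.continuous.mul hdiv.contDiff.continuous).integrable_of_hasCompactSupport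
        hdiv.hasCompactSupport.mul_left
    have hI2 : Integrable (fun z : ℝ × ℝ³ => ⟪uncurry (gradN g (φ k)) z, ψ z.1 z.2⟫) volume := by
      refine (hG.contDiff.continuous.inner hψ.contDiff.continuous).integrable_of_hasCompactSupport
        (hψ.hasCompactSupport.mono fun z hz => ?_)
      contrapose! hz
      simp only [mem_support, not_not] at hz ⊢
      change ψ z.1 z.2 = 0 at hz
      rw [hz, inner_zero_right]
    rw [Measure.volume_eq_prod, integral_prod _ (by rwa [← Measure.volume_eq_prod]),
      integral_prod _ (by rwa [← Measure.volume_eq_prod]), ← integral_neg]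
    refine integral_congr_ae (Eventually.of_forall fun t => ?_)
    have h := integral_inner_gradient_eq_neg_integral_mul_divergence
      (contDiff_infty.1 (contDiff_potential (contDiff_slice hg hp1.le (φ k) t)) 1)
      (contDiff_infty.1 (hψ.contDiff_slice t) 1) (hψ.hasCompactSupport_slice t)
    change ∫ y, potential (slice g (φ k) t) y * VectorCalculus.divergence (ψ t) y =
      -∫ y, ⟪gradient (potential (slice g (φ k) t)) y, ψ t y⟫
    rw [h, neg_neg]
  -- both sides pass to the limit
  obtain ⟨C₁, hC₁⟩ := hdiv.contDiff.continuous.bounded_above_of_compact_support hdiv.hasCompactSupport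
  obtain ⟨C₂, hC₂⟩ := hψ.contDiff.continuous.bounded_above_of_compact_support hψ.hasCompactSupport
  have hS : MeasurableSet (tsupport (uncurry ψ)) := (isClosed_tsupport _).measurableSet
  have hμS : volume (tsupport (uncurry ψ)) ≠ ⊤ := hψ.hasCompactSupport.measure_lt_top.ne
  have hL : Tendsto (fun k => ∫ z, uncurry (piN g (φ k)) z * VectorCalculus.divergence (ψ z.1) z.2)
      atTop (𝓝 (∫ z, π z * VectorCalculus.divergence (ψ z.1) z.2)) := by
    have := tendsto_integral_bilin_of_tendsto_eLpNorm (μ := volume) (ContinuousLinearMap.mul ℝ ℝ)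
      one_lt_p32.le (fun k => memLp_piN hg hp1.le hgs (φ k) p₃₂) hπ htπ
      (Ψ := fun z : ℝ × ℝ³ => VectorCalculus.divergence (ψ z.1) z.2)
      hdiv.contDiff.continuous.aestronglyMeasurable (fun z => hC₁ z) hS hμS
      (fun z hz => divergence_slice_eq_zero_of_notMem (ψ := ψ) (t := z.1) (x := z.2) hz)
    simpa only [ContinuousLinearMap.mul_apply'] using this
  have hR : Tendsto (fun k => -∫ z, ⟪uncurry (gradN g (φ k)) z, ψ z.1 z.2⟫)
      atTop (𝓝 (-∫ z, ⟪𝒢 z, ψ z.1 z.2⟫)) := by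
    have := tendsto_integral_bilin_of_tendsto_eLpNorm (μ := volume) (innerSL ℝ (E := ℝ³))
      hp1.le (fun k => memLp_gradN hg hp1.le hgs (φ k) p) h𝒢 ht𝒢
      (Ψ := fun z : ℝ × ℝ³ => ψ z.1 z.2)
      hψ.contDiff.continuous.aestronglyMeasurable (fun z => hC₂ z) hS hμS
      (fun z hz => (image_eq_zero_of_notMem_tsupport hz : uncurry ψ z = 0))
    have hR' : Tendsto (fun k => ∫ z, ⟪uncurry (gradN g (φ k)) z, ψ z.1 z.2⟫) atTop
        (𝓝 (∫ z, ⟪𝒢 z, ψ z.1 z.2⟫)) := this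
    exact hR'.neg
  rw [funext hk] at hL
  exact tendsto_nhds_unique hL hR

/-- **`g - 𝒢` is weakly divergence free on `Q₁`**: `∫∫ ⟪g - 𝒢, ∇θ⟫ = 0` for every scalar test
function `θ` on the open unit cylinder (at the smooth level `div (gₙ - ∇πₙ) = 0` on the ball
`B(x₀, 2)`, which contains the slices of the support of `θ`; then pass to the limit). [folklore] -/
theorem integral_inner_sub_limitG_gradient (hg : MemLp g p volume) (hp : p₃₂ ≤ p)
    (hgs : support g ⊆ parabolicCylinder 1 z₀) {φ : ℕ → ℕ} {𝒢 : ℝ × ℝ³ → ℝ³}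
    (h𝒢 : MemLp 𝒢 p volume)
    (ht𝒢 : Tendsto (fun k => eLpNorm (uncurry (gradN g (φ k)) - 𝒢) p volume) atTop (𝓝 0))
    (htg : Tendsto (fun k => eLpNorm (moll (φ k) g - g) p volume) atTop (𝓝 0))
    {θ : ℝ → ℝ³ → ℝ} (hθ : IsSpaceTimeTestOn (parabolicCylinderOpens 1 z₀) θ) :
    ∫ z, ⟪g z - 𝒢 z, gradient (θ z.1) z.2⟫ = 0 := by
  have hp1 : 1 < p := one_lt_p32.trans_le hp
  have hθ' : IsSpaceTimeTestOn (⊤ : Opens (ℝ × ℝ³)) θ := hθ.mono le_top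
  have hgradθ := isSpaceTimeTestOn_gradient hθ'
  -- slices of the support of `θ` lie in `B(x₀, 1)`
  have hθ0 : ∀ t x, x ∉ ball z₀.2 2 → θ t x = 0 := by
    intro t x hx
    by_contra h
    have hmem : (t, x) ∈ (parabolicCylinderOpens 1 z₀ : Set (ℝ × ℝ³)) :=
      hθ.tsupport_subset (subset_tsupport _ (show (t, x) ∈ support (uncurry θ) from h))
    have : x ∈ ball z₀.2 1 := (mem_parabolicCylinder.1 hmem).2
    exact hx (ball_subset_ball (by norm_num) this)
  -- the identity at the smooth level
  have hk : ∀ k, ∫ z, ⟪(moll (φ k) g - uncurry (gradN g (φ k))) z, gradient (θ z.1) z.2⟫ = 0 := by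
    intro k
    have hG := isSpaceTimeTestOn_gradN_top hg hp1.le hgs (φ k)
    have hcont : Continuous (moll (φ k) g - uncurry (gradN g (φ k))) :=
      (contDiff_moll hg hp1.le (φ k)).continuous.sub hG.contDiff.continuous
    have hI : Integrable (fun z : ℝ × ℝ³ =>
        ⟪(moll (φ k) g - uncurry (gradN g (φ k))) z, gradient (θ z.1) z.2⟫) volume := by
      refine (hcont.inner hgradθ.contDiff.continuous).integrable_of_hasCompactSupport
        (hgradθ.hasCompactSupport.mono fun z hz => ?_)
      contrapose! hz
      simp only [mem_support, not_not] at hz ⊢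
      change gradient (θ z.1) z.2 = 0 at hz
      rw [hz, inner_zero_right]
    rw [Measure.volume_eq_prod, integral_prod _ (by rwa [← Measure.volume_eq_prod])]
    refine integral_eq_zero_of_ae (Eventually.of_forall fun t => ?_)
    set H : ℝ³ → ℝ³ := fun y => slice g (φ k) t y - gradient (potential (slice g (φ k) t)) y
      with hH
    have hs := contDiff_slice hg hp1.le (φ k) t
    have hH1 : ContDiff ℝ 1 H := by
      refine (contDiff_infty.1 hs 1).sub ?_
      exact (InnerProductSpace.toDual ℝ ℝ³).symm.contDiff.comp
        ((contDiff_infty.1 (contDiff_potential hs) 2).fderiv_right (m := 1) le_rfl)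
    have h := integral_mul_divergence_add_eq_zero_left (contDiff_infty.1 (hθ'.contDiff_slice t) 1)
      hH1 (hθ'.hasCompactSupport_slice t)
    have h0 : ∫ x, θ t x * VectorCalculus.divergence H x = 0 := by
      refine integral_eq_zero_of_ae (Eventually.of_forall fun x => ?_)
      change θ t x * VectorCalculus.divergence H x = 0
      by_cases hx : x ∈ ball z₀.2 2
      · rw [hH, divergence_sub_gradient_potential_eq_zero hs (tsupport_slice_subset hgs _ t) hx,
          mul_zero]
      · rw [hθ0 t x hx, zero_mul]
    rw [h0, zero_add] at h
    exact h
  -- pass to the limit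
  obtain ⟨C, hC⟩ := hgradθ.contDiff.continuous.bounded_above_of_compact_support
    hgradθ.hasCompactSupport
  have hS : MeasurableSet (tsupport (uncurry θ)) := (isClosed_tsupport _).measurableSet
  have hμS : volume (tsupport (uncurry θ)) ≠ ⊤ := hθ.hasCompactSupport.measure_lt_top.ne
  have hmA : ∀ k, MemLp (moll (φ k) g - uncurry (gradN g (φ k))) p volume := fun k =>
    (memLp_moll hg hp1.le hgs (φ k) p).sub (memLp_gradN hg hp1.le hgs (φ k) p)
  have hconv : Tendsto (fun k => eLpNorm ((moll (φ k) g - uncurry (gradN g (φ k))) - (g - 𝒢)) p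
      volume) atTop (𝓝 0) := by
    have hle : ∀ k, eLpNorm ((moll (φ k) g - uncurry (gradN g (φ k))) - (g - 𝒢)) p volume ≤
        eLpNorm (moll (φ k) g - g) p volume + eLpNorm (uncurry (gradN g (φ k)) - 𝒢) p volume := by
      intro k
      have e : (moll (φ k) g - uncurry (gradN g (φ k))) - (g - 𝒢) =
          (moll (φ k) g - g) - (uncurry (gradN g (φ k)) - 𝒢) := by abel
      rw [e]
      exact eLpNorm_sub_le ((memLp_moll hg hp1.le hgs (φ k) p).1.sub hg.1)
        ((memLp_gradN hg hp1.le hgs (φ k) p).1.sub h𝒢.1) hp1.le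
    have hsum : Tendsto (fun k => eLpNorm (moll (φ k) g - g) p volume +
        eLpNorm (uncurry (gradN g (φ k)) - 𝒢) p volume) atTop (𝓝 (0 + 0)) := htg.add ht𝒢
    rw [add_zero] at hsum
    exact tendsto_of_tendsto_of_tendsto_of_le_of_le tendsto_const_nhds hsum (fun k => zero_le) hle
  have hL := tendsto_integral_bilin_of_tendsto_eLpNorm (μ := volume) (innerSL ℝ (E := ℝ³)) hp1.le
    hmA (hg.sub h𝒢) hconv (Ψ := fun z : ℝ × ℝ³ => gradient (θ z.1) z.2)
    hgradθ.contDiff.continuous.aestronglyMeasurable (fun z => hC z) hS hμS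
    (fun z hz => gradient_slice_eq_zero_of_notMem (θ := θ) (t := z.1) (x := z.2) hz)
  have hL' : Tendsto (fun k => ∫ z, ⟪(moll (φ k) g - uncurry (gradN g (φ k))) z, gradient (θ z.1) z.2⟫)
      atTop (𝓝 (∫ z, ⟪(g - 𝒢) z, gradient (θ z.1) z.2⟫)) := hL
  simp only [hk] at hL'
  have := tendsto_nhds_unique hL' tendsto_const_nhds
  simpa only [Pi.sub_apply] using this

end Limits

/-! ### The theorem -/

section Main

/-- **The localised Helmholtz decomposition of an `L^p` field on a parabolic cylinder.** For
`3/2 ≤ p < ∞` there are constants `C_p, C` such that: for every space–time point `z₀` and every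
`g ∈ L^p(ℝ × ℝ³; ℝ³)` supported in the unit parabolic cylinder `Q_1(z₀)` there are
`π ∈ L^{3/2}(ℝ × ℝ³)` and `𝒢 ∈ L^p(ℝ × ℝ³; ℝ³)` with `‖𝒢‖_{L^p} ≤ C_p ‖g‖_{L^p}`,
`‖π‖_{L^{3/2}} ≤ C ‖g‖_{L^{3/2}}`, `𝒢 = ∇ₓπ` weakly (`∫∫ π div ψ = -∫∫ ⟪𝒢, ψ⟫` for all vector test
fields `ψ`), `g - 𝒢` weakly divergence free on `Q_1(z₀)` (`∫∫ ⟪g - 𝒢, ∇θ⟫ = 0` for all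
`θ ∈ C_c^∞(Q_1(z₀))`), and smooth compactly supported `πₖ` with `πₖ → π` in `L^{3/2}`,
`∇ₓπₖ → 𝒢` in `L^p`. (The gradient part `𝒢` of `g` is "absorbed into the pressure" `π`;
Caffarelli–Kohn–Nirenberg 1982, §1.) [cite: CaffarelliKohnNirenberg1982, §1] -/
theorem exists_localHelmholtz {p : ℝ≥0∞} (hp : ((3 / 2 : ℝ≥0) : ℝ≥0∞) ≤ p) (hp' : p < ⊤) :
    ∃ Cg Cπ : ℝ≥0, ∀ (z₀ : ℝ × ℝ³) (g : ℝ × ℝ³ → ℝ³), MemLp g p volume →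
      support g ⊆ parabolicCylinder 1 z₀ →
      ∃ (π : ℝ × ℝ³ → ℝ) (𝒢 : ℝ × ℝ³ → ℝ³),
        MemLp π ((3 / 2 : ℝ≥0) : ℝ≥0∞) volume ∧ MemLp 𝒢 p volume ∧
        eLpNorm 𝒢 p volume ≤ Cg * eLpNorm g p volume ∧
        eLpNorm π ((3 / 2 : ℝ≥0) : ℝ≥0∞) volume ≤ Cπ * eLpNorm g ((3 / 2 : ℝ≥0) : ℝ≥0∞) volume ∧
        (∀ ψ : ℝ → ℝ³ → ℝ³, IsSpaceTimeTestOn (⊤ : Opens (ℝ × ℝ³)) ψ →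
          ∫ z, π z * VectorCalculus.divergence (ψ z.1) z.2 = -∫ z, ⟪𝒢 z, ψ z.1 z.2⟫) ∧
        (∀ θ : ℝ → ℝ³ → ℝ, IsSpaceTimeTestOn (parabolicCylinderOpens 1 z₀) θ →
          ∫ z, ⟪g z - 𝒢 z, gradient (θ z.1) z.2⟫ = 0) ∧
        ∃ πs : ℕ → ℝ → ℝ³ → ℝ, (∀ k, IsSpaceTimeTestOn (⊤ : Opens (ℝ × ℝ³)) (πs k)) ∧
          Tendsto (fun k => eLpNorm (uncurry (πs k) - π) ((3 / 2 : ℝ≥0) : ℝ≥0∞) volume)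
            atTop (𝓝 0) ∧
          Tendsto (fun k => eLpNorm ((uncurry fun t x => gradient (πs k t) x) - 𝒢) p volume)
            atTop (𝓝 0) := by
  have hp1 : 1 < p := one_lt_p32.trans_le hp
  obtain ⟨Cg, hCg⟩ := exists_eLpNorm_gradient_potential_le hp1 hp'
  obtain ⟨Cπ, hCπ⟩ := exists_eLpNorm_potential_le
  refine ⟨Cg, Cπ, fun z₀ g hg hgs => ?_⟩
  obtain ⟨φ, π, 𝒢, -, hπ, h𝒢, htπ, ht𝒢, htg, -⟩ := exists_limits hg hp hp' hgs hCg hCπ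
  refine ⟨π, 𝒢, hπ, h𝒢, eLpNorm_limitG_le hg hp hp' hgs hCg h𝒢 ht𝒢,
    eLpNorm_limitP_le hg hp hgs hCπ hπ htπ,
    fun ψ hψ => integral_limitP_mul_divergence hg hp hgs hπ h𝒢 htπ ht𝒢 hψ,
    fun θ hθ => integral_inner_sub_limitG_gradient hg hp hgs h𝒢 ht𝒢 htg hθ,
    fun k => piN g (φ k), fun k => isSpaceTimeTestOn_piN_top hg hp1.le hgs (φ k), htπ, ?_⟩
  exact ht𝒢

end Main

end LocalHelmholtz

end Literature.Analysis.FluidPDE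

end
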